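import Summits.Ventures.DiscreteObjects.Hadamard.Order25FifthPowerFixed668

/-!
# Orbit representatives for a free action, and three inequalities for `±1` vectors on a finset (kernel, general tools)

Framing: lottery ticket; floor = certified bounds/negative ranges.

Cell pub-namedobj (venture DiscreteObjects), target (H), hadamard gen 18.  General lemmas used by `Order25FixedEight668`
(and reusable for every 'orbit-sign vector' argument on the fixed rows of an automorphism):
* `pow_apply_mem_orbFin_of_fixed`, `free_of_fixed_prime_pow`: pointwise versions of the `orbFin` membership / freeness
  facts (only `(κ^n) y = y` at the point is needed, not `κ^n = 1`);
* **`exists_orbit_reps`**: if `Y` is `κ`-stable and every point of `Y` has `(κ^n) y = y` and is free below `n`, there is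
  a transversal `T ⊆ Y` with `n·|T| = |Y|` and `Σ_{y∈Y} g = n·Σ_{t∈T} g` for every `κ`-invariant `g`
  (induction peeling one orbit, as in `dvd_sum_of_free`);
* **`pm_three_inner_mod4`**: for three `±1` vectors on `T`, `4 ∣ |T| + ⟨u,v⟩ + ⟨u,w⟩ + ⟨v,w⟩`
  (`Σ (u+v)(u+w)`, every term in `{0, ±4}`; generalises `four_dvd_card_of_three_orth`);
* **`pm_inner_triangle`**, `pm_inner_triangle_abs`: the Hamming triangle inequality in inner-product form,
  `⟨q,p⟩ + ⟨p,r⟩ − |T| ≤ ⟨q,r⟩` (termwise `(q−p)(r−p) ≥ 0`) and `|⟨q,p⟩| + |⟨p,r⟩| − |T| ≤ |⟨q,r⟩|`;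
* **`pm_welch`**: the Welch / frame bound `|T|·|X|² ≤ Σ_{x,y∈X} ⟨v_x,v_y⟩²` for `±1` vectors `v_x` (`x ∈ X`) on `T`
  [the double sum equals `Σ_{t,s∈T} (Σ_x v_x(t)v_x(s))²`, whose diagonal terms are `|X|²`].
Elementary; ours, not literature; no `sorry`, no definitions.
-/

namespace Summit.Ventures.DiscreteObjects.Hadamard

open Finset BigOperators Matrix

variable {ι : Type*} [DecidableEq ι]

/-! ### orbit representatives for a free action with pointwise period `n` -/

/-- if `(κ^n) y = y` then every `κ^m y` lies in `orbFin κ n y` -/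
lemma pow_apply_mem_orbFin_of_fixed (κ : Equiv.Perm ι) {n : ℕ} (hn : 0 < n) {y : ι} (hy : (κ ^ n) y = y)
    (m : ℕ) : (κ ^ m) y ∈ orbFin κ n y := by
  refine Finset.mem_image.mpr ⟨m % n, Finset.mem_range.mpr (Nat.mod_lt _ hn), ?_⟩
  conv_rhs => rw [← Nat.mod_add_div m n, pow_add, Equiv.Perm.mul_apply, pow_mul,
    perm_pow_apply_of_fixed (κ ^ n) hy (m / n)]

omit [DecidableEq ι] in
/-- a point with `(κ^p) y = y`, `κ y ≠ y`, `p` prime, is free below `p` -/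
lemma free_of_fixed_prime_pow (κ : Equiv.Perm ι) {p : ℕ} (hp : p.Prime) {y : ι} (hy : (κ ^ p) y = y)
    (hy1 : κ y ≠ y) : ∀ k, 0 < k → k < p → (κ ^ k) y ≠ y := by
  intro k hk0 hk hfix
  have h1 : Function.IsPeriodicPt κ k y := by
    show (⇑κ)^[k] y = y
    rw [Equiv.Perm.iterate_eq_pow]; exact hfix
  have h2 : Function.IsPeriodicPt κ p y := by
    show (⇑κ)^[p] y = y
    rw [Equiv.Perm.iterate_eq_pow]; exact hy
  have h3 := h1.gcd h2
  have hg : Nat.gcd k p = 1 := (Nat.coprime_of_lt_prime (by omega) hk hp).symm.gcd_eq_one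
  rw [hg] at h3
  have h5 : (⇑κ)^[1] y = y := h3
  exact hy1 (by simpa using h5)

/-- **Orbit representatives.**  If `Y` is `κ`-stable, every point of `Y` satisfies `(κ^n) y = y` and is free below
`n`, then there is `T ⊆ Y` with `n·|T| = |Y|` and `Σ_{y∈Y} g y = n · Σ_{t∈T} g t` for every `κ`-invariant `g`. -/
lemma exists_orbit_reps (κ : Equiv.Perm ι) {n : ℕ} (hn : 0 < n) :
    ∀ (N : ℕ) (Y : Finset ι), Y.card ≤ N → (∀ y ∈ Y, κ y ∈ Y) → (∀ y ∈ Y, (κ ^ n) y = y) →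
      (∀ y ∈ Y, ∀ k, 0 < k → k < n → (κ ^ k) y ≠ y) →
      ∃ T : Finset ι, T ⊆ Y ∧ n * T.card = Y.card ∧
        ∀ g : ι → ℤ, (∀ y, g (κ y) = g y) → ∑ y ∈ Y, g y = n * ∑ t ∈ T, g t := by
  intro N
  induction N with
  | zero =>
    intro Y hY _ _ _
    refine ⟨∅, Finset.empty_subset _, ?_, fun g _ => ?_⟩
    · rw [Finset.card_eq_zero.mp (Nat.le_zero.mp hY)]; simp
    · rw [Finset.card_eq_zero.mp (Nat.le_zero.mp hY)]; simp
  | succ N ih =>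
    intro Y hY hstab hper hfree
    rcases Y.eq_empty_or_nonempty with hYe | ⟨y, hy⟩
    · refine ⟨∅, Finset.empty_subset _, ?_, fun g _ => ?_⟩
      · rw [hYe]; simp
      · rw [hYe]; simp
    · have hO : orbFin κ n y ⊆ Y := orbFin_subset_of_stable Y hstab hy
      have hOc : (orbFin κ n y).card = n := card_orbFin_of_free (hfree y hy)
      have hcard : (Y \ orbFin κ n y).card + n = Y.card := by
        have h := Finset.card_sdiff_add_card_eq_card hO
        rw [hOc] at h
        exact h
      have hstab' : ∀ z ∈ Y \ orbFin κ n y, κ z ∈ Y \ orbFin κ n y := by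
        intro z hz
        rw [Finset.mem_sdiff] at hz ⊢
        refine ⟨hstab z hz.1, fun hκz => hz.2 ?_⟩
        have e : z = (κ ^ (n - 1)) (κ z) := by
          rw [← Equiv.Perm.mul_apply, ← pow_succ, Nat.sub_add_cancel hn, hper z hz.1]
        rw [e]
        obtain ⟨i, -, hi⟩ := Finset.mem_image.mp hκz
        rw [← hi, ← Equiv.Perm.mul_apply, ← pow_add]
        exact pow_apply_mem_orbFin_of_fixed κ hn (hper y hy) _
      have hper' : ∀ z ∈ Y \ orbFin κ n y, (κ ^ n) z = z := fun z hz => hper z (Finset.mem_sdiff.mp hz).1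
      have hfree' : ∀ z ∈ Y \ orbFin κ n y, ∀ k, 0 < k → k < n → (κ ^ k) z ≠ z :=
        fun z hz => hfree z (Finset.mem_sdiff.mp hz).1
      have hlt : (Y \ orbFin κ n y).card ≤ N := by omega
      obtain ⟨T', hT'sub, hT'card, hT'sum⟩ := ih (Y \ orbFin κ n y) hlt hstab' hper' hfree'
      have hyT' : y ∉ T' := by
        intro h
        have := hT'sub h
        rw [Finset.mem_sdiff] at this
        exact this.2 (mem_orbFin_self κ hn y)
      refine ⟨insert y T', ?_, ?_, fun g hg => ?_⟩
      · intro t ht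
        rcases Finset.mem_insert.mp ht with rfl | ht
        · exact hy
        · exact (Finset.mem_sdiff.mp (hT'sub ht)).1
      · rw [Finset.card_insert_of_notMem hyT', Nat.mul_succ, hT'card, hcard]
      · rw [← Finset.sum_sdiff hO, hT'sum g hg, sum_orbFin_of_invariant (hfree y hy) g hg,
          Finset.sum_insert hyT']
        ring

/-! ### three inequalities for `±1` vectors on a finset -/

omit [DecidableEq ι] in
/-- **mod-4 rule for three `±1` vectors**: `4 ∣ |T| + ⟨u,v⟩ + ⟨u,w⟩ + ⟨v,w⟩`. -/
lemma pm_three_inner_mod4 (T : Finset ι) (u v w : ι → ℤ)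
    (hu : ∀ t ∈ T, u t = 1 ∨ u t = -1) (hv : ∀ t ∈ T, v t = 1 ∨ v t = -1) (hw : ∀ t ∈ T, w t = 1 ∨ w t = -1) :
    (4 : ℤ) ∣ T.card + ∑ t ∈ T, u t * v t + ∑ t ∈ T, u t * w t + ∑ t ∈ T, v t * w t := by
  have hsum : ∑ t ∈ T, (u t + v t) * (u t + w t) =
      T.card + ∑ t ∈ T, u t * v t + ∑ t ∈ T, u t * w t + ∑ t ∈ T, v t * w t := by
    have h1 : ∀ t ∈ T, (u t + v t) * (u t + w t) = 1 + u t * v t + u t * w t + v t * w t := by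
      intro t ht
      rw [show (u t + v t) * (u t + w t) = u t * u t + u t * v t + u t * w t + v t * w t by ring,
        pm_mul_self (hu t ht)]
    rw [Finset.sum_congr rfl h1, Finset.sum_add_distrib, Finset.sum_add_distrib, Finset.sum_add_distrib,
      Finset.sum_const, nsmul_eq_mul, mul_one]
  have hdvd : ∀ t ∈ T, (4 : ℤ) ∣ (u t + v t) * (u t + w t) := by
    intro t ht
    rcases hu t ht with h1 | h1 <;> rcases hv t ht with h2 | h2 <;> rcases hw t ht with h3 | h3 <;>
      (rw [h1, h2, h3]; norm_num)
  rw [← hsum]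
  exact Finset.dvd_sum hdvd

omit [DecidableEq ι] in
/-- **Hamming triangle inequality for `±1` vectors**: `⟨q,p⟩ + ⟨p,r⟩ − |T| ≤ ⟨q,r⟩`
[termwise `(q − p)(r − p) ≥ 0`]. -/
lemma pm_inner_triangle (T : Finset ι) (p q r : ι → ℤ)
    (hp : ∀ t ∈ T, p t = 1 ∨ p t = -1) (hq : ∀ t ∈ T, q t = 1 ∨ q t = -1) (hr : ∀ t ∈ T, r t = 1 ∨ r t = -1) :
    ∑ t ∈ T, q t * p t + ∑ t ∈ T, p t * r t - T.card ≤ ∑ t ∈ T, q t * r t := by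
  have h1 : ∀ t ∈ T, q t * p t + p t * r t - 1 ≤ q t * r t := by
    intro t ht
    rcases hp t ht with h1 | h1 <;> rcases hq t ht with h2 | h2 <;> rcases hr t ht with h3 | h3 <;>
      (rw [h1, h2, h3]; norm_num)
  have h2 : ∑ t ∈ T, q t * p t + ∑ t ∈ T, p t * r t - T.card = ∑ t ∈ T, (q t * p t + p t * r t - 1) := by
    rw [Finset.sum_sub_distrib, Finset.sum_add_distrib, Finset.sum_const, nsmul_eq_mul, mul_one]
  rw [h2]
  exact Finset.sum_le_sum h1

omit [DecidableEq ι] in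
/-- a sign realising the absolute value -/
lemma exists_sign_mul_eq_abs (s : ℤ) : ∃ ε : ℤ, (ε = 1 ∨ ε = -1) ∧ ε * s = |s| := by
  rcases le_or_gt 0 s with h | h
  · exact ⟨1, Or.inl rfl, by rw [one_mul, abs_of_nonneg h]⟩
  · exact ⟨-1, Or.inr rfl, by rw [abs_of_neg h]; ring⟩

omit [DecidableEq ι] in
/-- **absolute form**: `|⟨q,p⟩| + |⟨p,r⟩| − |T| ≤ |⟨q,r⟩|` for `±1` vectors. -/
lemma pm_inner_triangle_abs (T : Finset ι) (p q r : ι → ℤ)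
    (hp : ∀ t ∈ T, p t = 1 ∨ p t = -1) (hq : ∀ t ∈ T, q t = 1 ∨ q t = -1) (hr : ∀ t ∈ T, r t = 1 ∨ r t = -1) :
    |∑ t ∈ T, q t * p t| + |∑ t ∈ T, p t * r t| - T.card ≤ |∑ t ∈ T, q t * r t| := by
  obtain ⟨ε, hε, hεs⟩ := exists_sign_mul_eq_abs (∑ t ∈ T, q t * p t)
  obtain ⟨ε', hε', hε's⟩ := exists_sign_mul_eq_abs (∑ t ∈ T, p t * r t)
  have hq' : ∀ t ∈ T, ε * q t = 1 ∨ ε * q t = -1 := by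
    intro t ht; rcases hε with h | h <;> rcases hq t ht with h' | h' <;> simp [h, h']
  have hr' : ∀ t ∈ T, ε' * r t = 1 ∨ ε' * r t = -1 := by
    intro t ht; rcases hε' with h | h <;> rcases hr t ht with h' | h' <;> simp [h, h']
  have htri := pm_inner_triangle T p (fun t => ε * q t) (fun t => ε' * r t) hp hq' hr'
  have e1 : ∑ t ∈ T, ε * q t * p t = ε * ∑ t ∈ T, q t * p t := by
    rw [Finset.mul_sum]; exact Finset.sum_congr rfl (fun t _ => by ring)
  have e2 : ∑ t ∈ T, p t * (ε' * r t) = ε' * ∑ t ∈ T, p t * r t := by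
    rw [Finset.mul_sum]; exact Finset.sum_congr rfl (fun t _ => by ring)
  have e3 : ∑ t ∈ T, ε * q t * (ε' * r t) = (ε * ε') * ∑ t ∈ T, q t * r t := by
    rw [Finset.mul_sum]; exact Finset.sum_congr rfl (fun t _ => by ring)
  rw [e1, e2, e3, hεs, hε's] at htri
  have hbound : (ε * ε') * ∑ t ∈ T, q t * r t ≤ |∑ t ∈ T, q t * r t| := by
    rcases hε with h | h <;> rcases hε' with h' | h' <;> subst h <;> subst h' <;>
      simp [le_abs_self, neg_le_abs]
  linarith

omit [DecidableEq ι] in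
/-- **Welch / frame bound for `±1` vectors**: `|T|·|X|² ≤ Σ_{x,y ∈ X} ⟨v_x, v_y⟩²` (the diagonal of the `T × T` Gram
matrix of the coordinate vectors is `|X|`). -/
lemma pm_welch (X T : Finset ι) (v : ι → ι → ℤ) (hv : ∀ x ∈ X, ∀ t ∈ T, v x t = 1 ∨ v x t = -1) :
    (T.card : ℤ) * (X.card : ℤ) ^ 2 ≤ ∑ x ∈ X, ∑ y ∈ X, (∑ t ∈ T, v x t * v y t) ^ 2 := by
  have key : ∑ x ∈ X, ∑ y ∈ X, (∑ t ∈ T, v x t * v y t) ^ 2 =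
      ∑ t ∈ T, ∑ s ∈ T, (∑ x ∈ X, v x t * v x s) ^ 2 := by
    simp only [sq, Finset.sum_mul_sum]
    calc ∑ x ∈ X, ∑ y ∈ X, ∑ t ∈ T, ∑ s ∈ T, v x t * v y t * (v x s * v y s)
        = ∑ x ∈ X, ∑ t ∈ T, ∑ y ∈ X, ∑ s ∈ T, v x t * v y t * (v x s * v y s) :=
          Finset.sum_congr rfl (fun x _ => Finset.sum_comm)
      _ = ∑ x ∈ X, ∑ t ∈ T, ∑ s ∈ T, ∑ y ∈ X, v x t * v y t * (v x s * v y s) :=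
          Finset.sum_congr rfl (fun x _ => Finset.sum_congr rfl (fun t _ => Finset.sum_comm))
      _ = ∑ t ∈ T, ∑ x ∈ X, ∑ s ∈ T, ∑ y ∈ X, v x t * v y t * (v x s * v y s) := Finset.sum_comm
      _ = ∑ t ∈ T, ∑ s ∈ T, ∑ x ∈ X, ∑ y ∈ X, v x t * v y t * (v x s * v y s) :=
          Finset.sum_congr rfl (fun t _ => Finset.sum_comm)
      _ = ∑ t ∈ T, ∑ s ∈ T, ∑ x ∈ X, ∑ y ∈ X, v x t * v x s * (v y t * v y s) :=
          Finset.sum_congr rfl (fun t _ => Finset.sum_congr rfl (fun s _ =>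
            Finset.sum_congr rfl (fun x _ => Finset.sum_congr rfl (fun y _ => by ring))))
  rw [key]
  have hdiag : ∀ t ∈ T, ∑ x ∈ X, v x t * v x t = X.card := by
    intro t ht
    rw [Finset.sum_congr rfl (fun x hx => pm_mul_self (hv x hx t ht)), Finset.sum_const, nsmul_eq_mul, mul_one]
  have hle : ∀ t ∈ T, (X.card : ℤ) ^ 2 ≤ ∑ s ∈ T, (∑ x ∈ X, v x t * v x s) ^ 2 := by
    intro t ht
    rw [← hdiag t ht]
    exact Finset.single_le_sum (f := fun s => (∑ x ∈ X, v x t * v x s) ^ 2) (fun s _ => sq_nonneg _) ht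
  calc (T.card : ℤ) * (X.card : ℤ) ^ 2 = ∑ t ∈ T, (X.card : ℤ) ^ 2 := by
        rw [Finset.sum_const, nsmul_eq_mul]
    _ ≤ _ := Finset.sum_le_sum hle

end Summit.Ventures.DiscreteObjects.Hadamard
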